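import Mathlib

/-!
# `IsometryAtoms.AtomicLawChargesCrystal` (stmt-AtomisticToContinuum-15778), line `Sketch`:
# stub `stub_smallPartsCommute` (Bieberbach's lemma for Delone sets in `ℝ³`)

**Small linear parts of symmetries of a Delone set commute.**  Let `D ⊆ ℝ³` be a Delone set and
`g₁, g₂` affine isometries with `gᵢ '' D = D` whose linear parts `Aᵢ` satisfy `‖Aᵢ x - x‖ ≤ ‖x‖ / 10`.
Then `A₁ A₂ = A₂ A₁`.  The statement carries as hypotheses (i) the affine-frame lemma (an affine
isometry fixing the patch `D ∩ B̄(x, 20 R_c)` pointwise is the identity) and three facts on linear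
isometries of `ℝ³` near the identity: (T1) existence of a fixed unit vector, (T2) the fixed space of a
non-trivial one is the axis line, (T5) two of them with a common axis commute.

Proof (commutator contraction, after Bieberbach / Buser; W. P. Thurston, *Three-Dimensional Geometry
and Topology* I, §4.1).  Put `κ₀ = g₂`, `κ_{j+1} = g₁ κ_j g₁⁻¹ κ_j⁻¹ ∈ Sym D`, with linear parts
`C_{j+1} = A₁ C_j A₁⁻¹ C_j⁻¹` and translation parts `t_j = κ_j x₀ - x₀` at a base point `x₀ ∈ D`.
Pointwise estimates: `‖[A, B] x - x‖ ≤ 2ab‖x‖` for `a`-small `A` and `b`-small `B`, and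
`t_{[g,h]} = (1 - ABA⁻¹) t_g + (A - ABA⁻¹B⁻¹) t_h`; hence by induction `C_j` is `(1/10)(1/2)ʲ`-small and
`‖t_j‖ ≤ T₀ (1/2)ʲ`.  For `J` large, `κ_J` moves every point of the patch `D ∩ B̄(x₀, 20 R_c)` by less
than the packing radius, so fixes it, so `κ_J = 1` by (i) and `C_J = 1`.  Downward induction: if
`C_{j+1} u₁ = u₁` for the axis `u₁` of `A₁` (T1), then `C_j⁻¹ u₁` is fixed by `A₁`, hence `= ± u₁` (T2),
and `-` is excluded by smallness of `C_j`; so `C_j u₁ = u₁`.  At `j = 0`: `A₂ u₁ = u₁`, and (T5) ends.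
-/

noncomputable section

namespace Summit.AtomisticToContinuum.Crystallization.Theorems.IsometryAtomsAtomicLawChargesCrystal

/-! ### Symmetries of a set are closed under products and inverses -/

/-- The symmetries `{g | g '' X = X}` are closed under multiplication. [folklore] -/
theorem g1a_image_mul {X : Set (EuclideanSpace ℝ (Fin 3))}
    {g h : EuclideanSpace ℝ (Fin 3) ≃ᵃⁱ[ℝ] EuclideanSpace ℝ (Fin 3)}
    (hg : g '' X = X) (hh : h '' X = X) : (g * h) '' X = X := by
  rw [AffineIsometryEquiv.coe_mul, Set.image_comp, hh, hg]

/-- The symmetries `{g | g '' X = X}` are closed under inversion. [folklore] -/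
theorem g1a_image_inv {X : Set (EuclideanSpace ℝ (Fin 3))}
    {g : EuclideanSpace ℝ (Fin 3) ≃ᵃⁱ[ℝ] EuclideanSpace ℝ (Fin 3)}
    (hg : g '' X = X) : ⇑(g⁻¹) '' X = X := by
  have h := congrArg (fun s => g.symm '' s) hg
  simp only [Set.image_image, AffineIsometryEquiv.symm_apply_apply, Set.image_id'] at h
  rw [AffineIsometryEquiv.coe_inv]
  exact h.symm

/-! ### Linear and translation parts of products, inverses and commutators -/

/-- Linear part of a product (definitional). [folklore] -/
theorem g1a_lin_mul (g h : EuclideanSpace ℝ (Fin 3) ≃ᵃⁱ[ℝ] EuclideanSpace ℝ (Fin 3))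
    (x : EuclideanSpace ℝ (Fin 3)) :
    (g * h).linearIsometryEquiv x = g.linearIsometryEquiv (h.linearIsometryEquiv x) := rfl

/-- Linear part of an inverse (definitional). [folklore] -/
theorem g1a_lin_inv (g : EuclideanSpace ℝ (Fin 3) ≃ᵃⁱ[ℝ] EuclideanSpace ℝ (Fin 3))
    (x : EuclideanSpace ℝ (Fin 3)) :
    g⁻¹.linearIsometryEquiv x = g.linearIsometryEquiv.symm x := rfl

/-- Affine decomposition at a base point: `g y = A (y - x₀) + g x₀`. [folklore] -/
theorem g1a_decomp (g : EuclideanSpace ℝ (Fin 3) ≃ᵃⁱ[ℝ] EuclideanSpace ℝ (Fin 3))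
    (x₀ y : EuclideanSpace ℝ (Fin 3)) :
    g y = g.linearIsometryEquiv (y - x₀) + g x₀ := by
  have h := g.map_vadd x₀ (y - x₀)
  simpa [vadd_eq_add, sub_add_cancel] using h

/-- Translation part (at `x₀`) of a product: `t_{gh} = A t_h + t_g`. [folklore] -/
theorem g1a_t_mul (g h : EuclideanSpace ℝ (Fin 3) ≃ᵃⁱ[ℝ] EuclideanSpace ℝ (Fin 3))
    (x₀ : EuclideanSpace ℝ (Fin 3)) :
    (g * h) x₀ - x₀ = g.linearIsometryEquiv (h x₀ - x₀) + (g x₀ - x₀) := by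
  rw [AffineIsometryEquiv.coe_mul, Function.comp_apply, g1a_decomp g x₀ (h x₀)]
  abel

/-- Translation part (at `x₀`) of an inverse: `t_{g⁻¹} = -A⁻¹ t_g`. [folklore] -/
theorem g1a_t_inv (g : EuclideanSpace ℝ (Fin 3) ≃ᵃⁱ[ℝ] EuclideanSpace ℝ (Fin 3))
    (x₀ : EuclideanSpace ℝ (Fin 3)) :
    g⁻¹ x₀ - x₀ = -(g.linearIsometryEquiv.symm (g x₀ - x₀)) := by
  have h1 : g (g⁻¹ x₀) = x₀ := by simp
  rw [g1a_decomp g x₀ (g⁻¹ x₀)] at h1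
  have h2 : g.linearIsometryEquiv (g⁻¹ x₀ - x₀) = -(g x₀ - x₀) := by
    rw [eq_sub_of_add_eq h1, neg_sub]
  calc g⁻¹ x₀ - x₀ = g.linearIsometryEquiv.symm (g.linearIsometryEquiv (g⁻¹ x₀ - x₀)) := by simp
    _ = -(g.linearIsometryEquiv.symm (g x₀ - x₀)) := by rw [h2, map_neg]

/-- Translation part (at `x₀`) of a commutator:
`t_{[g,h]} = (t_g - ABA⁻¹ t_g) + (A t_h - ABA⁻¹B⁻¹ t_h)`. [folklore] -/
theorem g1a_t_comm (g h : EuclideanSpace ℝ (Fin 3) ≃ᵃⁱ[ℝ] EuclideanSpace ℝ (Fin 3))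
    (x₀ : EuclideanSpace ℝ (Fin 3)) :
    (g * h * g⁻¹ * h⁻¹) x₀ - x₀ =
      ((g x₀ - x₀) - g.linearIsometryEquiv (h.linearIsometryEquiv
          (g.linearIsometryEquiv.symm (g x₀ - x₀)))) +
      (g.linearIsometryEquiv (h x₀ - x₀) - g.linearIsometryEquiv (h.linearIsometryEquiv
          (g.linearIsometryEquiv.symm (h.linearIsometryEquiv.symm (h x₀ - x₀))))) := by
  rw [g1a_t_mul (g * h * g⁻¹) h⁻¹ x₀, g1a_t_inv h x₀, g1a_t_mul (g * h) g⁻¹ x₀, g1a_t_inv g x₀,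
    g1a_t_mul g h x₀]
  simp only [g1a_lin_mul, g1a_lin_inv, map_neg]
  abel

/-! ### Pointwise smallness estimates for linear isometries -/

/-- The inverse of an `a`-small linear isometry is `a`-small. [folklore] -/
theorem g1a_small_symm {A : EuclideanSpace ℝ (Fin 3) ≃ₗᵢ[ℝ] EuclideanSpace ℝ (Fin 3)} {a : ℝ}
    (hA : ∀ x, ‖A x - x‖ ≤ a * ‖x‖) (x : EuclideanSpace ℝ (Fin 3)) :
    ‖A.symm x - x‖ ≤ a * ‖x‖ := by
  have h : A.symm x - x = A.symm (x - A x) := by simp [map_sub]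
  rw [h, LinearIsometryEquiv.norm_map, norm_sub_rev]
  exact hA x

/-- A conjugate `ABA⁻¹` of a `b`-small linear isometry `B` is `b`-small. [folklore] -/
theorem g1a_small_conj (A : EuclideanSpace ℝ (Fin 3) ≃ₗᵢ[ℝ] EuclideanSpace ℝ (Fin 3))
    {B : EuclideanSpace ℝ (Fin 3) ≃ₗᵢ[ℝ] EuclideanSpace ℝ (Fin 3)} {b : ℝ}
    (hB : ∀ x, ‖B x - x‖ ≤ b * ‖x‖) (x : EuclideanSpace ℝ (Fin 3)) :
    ‖A (B (A.symm x)) - x‖ ≤ b * ‖x‖ := by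
  have h : A (B (A.symm x)) - x = A (B (A.symm x) - A.symm x) := by simp [map_sub]
  rw [h, LinearIsometryEquiv.norm_map]
  simpa using hB (A.symm x)

/-- **Commutator contraction.** For an `a`-small `A` and a `b`-small `B`, the commutator
`ABA⁻¹B⁻¹` is `2ab`-small: `AB - BA = (A-1)(B-1) - (B-1)(A-1)`. [folklore] -/
theorem g1a_small_comm {A B : EuclideanSpace ℝ (Fin 3) ≃ₗᵢ[ℝ] EuclideanSpace ℝ (Fin 3)} {a b : ℝ}
    (ha : 0 ≤ a) (hb : 0 ≤ b)
    (hA : ∀ x, ‖A x - x‖ ≤ a * ‖x‖) (hB : ∀ x, ‖B x - x‖ ≤ b * ‖x‖)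
    (x : EuclideanSpace ℝ (Fin 3)) :
    ‖A (B (A.symm (B.symm x))) - x‖ ≤ 2 * a * b * ‖x‖ := by
  set y := A.symm (B.symm x) with hy
  have hx : x = B (A y) := by simp [hy]
  have hnorm : ‖y‖ = ‖x‖ := by simp [hy]
  have key : A (B y) - x = (A (B y - y) - (B y - y)) - (B (A y - y) - (A y - y)) := by
    rw [hx]; simp only [map_sub]; abel
  rw [key]
  have h1 : ‖A (B y - y) - (B y - y)‖ ≤ a * b * ‖x‖ :=
    calc ‖A (B y - y) - (B y - y)‖ ≤ a * ‖B y - y‖ := hA _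
      _ ≤ a * (b * ‖y‖) := by gcongr; exact hB y
      _ = a * b * ‖x‖ := by rw [hnorm]; ring
  have h2 : ‖B (A y - y) - (A y - y)‖ ≤ a * b * ‖x‖ :=
    calc ‖B (A y - y) - (A y - y)‖ ≤ b * ‖A y - y‖ := hB _
      _ ≤ b * (a * ‖y‖) := by gcongr; exact hA y
      _ = a * b * ‖x‖ := by rw [hnorm]; ring
  calc ‖(A (B y - y) - (B y - y)) - (B (A y - y) - (A y - y))‖
      ≤ ‖A (B y - y) - (B y - y)‖ + ‖B (A y - y) - (A y - y)‖ := norm_sub_le _ _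
    _ ≤ a * b * ‖x‖ + a * b * ‖x‖ := add_le_add h1 h2
    _ = 2 * a * b * ‖x‖ := by ring

/-- **Translation part of a commutator.** For `g = (A, t_g)` with `A` `a`-small and `h = (B, t_h)` with
`B` `b`-small: `‖t_{[g,h]}‖ ≤ b ‖t_g‖ + (a + 2ab) ‖t_h‖`. [folklore] -/
theorem g1a_t_comm_bound {g h : EuclideanSpace ℝ (Fin 3) ≃ᵃⁱ[ℝ] EuclideanSpace ℝ (Fin 3)} {a b : ℝ}
    (ha : 0 ≤ a) (hb : 0 ≤ b)
    (hA : ∀ x, ‖g.linearIsometryEquiv x - x‖ ≤ a * ‖x‖)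
    (hB : ∀ x, ‖h.linearIsometryEquiv x - x‖ ≤ b * ‖x‖) (x₀ : EuclideanSpace ℝ (Fin 3)) :
    ‖(g * h * g⁻¹ * h⁻¹) x₀ - x₀‖ ≤ b * ‖g x₀ - x₀‖ + (a + 2 * a * b) * ‖h x₀ - x₀‖ := by
  rw [g1a_t_comm]
  refine (norm_add_le _ _).trans (add_le_add ?_ ?_)
  · rw [norm_sub_rev]
    exact g1a_small_conj _ hB _
  · calc _ ≤ ‖g.linearIsometryEquiv (h x₀ - x₀) - (h x₀ - x₀)‖ + ‖(h x₀ - x₀) -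
          g.linearIsometryEquiv (h.linearIsometryEquiv (g.linearIsometryEquiv.symm
            (h.linearIsometryEquiv.symm (h x₀ - x₀))))‖ := norm_sub_le_norm_sub_add_norm_sub _ _ _
      _ ≤ a * ‖h x₀ - x₀‖ + 2 * a * b * ‖h x₀ - x₀‖ := by
          refine add_le_add (hA _) ?_
          rw [norm_sub_rev]
          exact g1a_small_comm ha hb hA hB _
      _ = (a + 2 * a * b) * ‖h x₀ - x₀‖ := by ring

/-- Arithmetic of the contraction step for the translation parts. [folklore] -/
theorem g1a_arith {p T T₀ τ : ℝ} (hp : 0 ≤ p) (hp1 : p ≤ 1) (hT : T ≤ T₀)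
    (hτ0 : 0 ≤ τ) (hτ : τ ≤ T₀ * p) :
    1 / 10 * p * T + (1 / 10 + 2 * (1 / 10) * (1 / 10 * p)) * τ ≤ T₀ * (p * (1 / 2)) := by
  have h1 : p * T ≤ p * T₀ := mul_le_mul_of_nonneg_left hT hp
  have h2 : p * τ ≤ 1 * τ := mul_le_mul_of_nonneg_right hp1 hτ0
  nlinarith

/-! ### The stub -/

/-- **Stub `stub_smallPartsCommute` of line `Sketch` (Bieberbach's lemma).**  For a Delone set
`D ⊆ ℝ³` and two symmetries `g₁, g₂` of `D` whose linear parts are pointwise `1/10`-close to the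
identity, the linear parts commute — given (as hypotheses) the affine-frame lemma for patches of radius
`20 R_c` and the three `SO(3)` facts (T1), (T2), (T5).  Proof by commutator contraction
`κ_{j+1} = [g₁, κ_j]`, discreteness (`κ_J = 1`), and downward induction on the axis of `A₁`.
(W. P. Thurston, *Three-Dimensional Geometry and Topology* I, §4.1; P. Buser, 1985.) -/
theorem stub_smallPartsCommute :
    (∀ (D : Delone.DeloneSet (EuclideanSpace ℝ (Fin 3))) (g : EuclideanSpace ℝ (Fin 3) ≃ᵃⁱ[ℝ] EuclideanSpace ℝ (Fin 3)), ∀ x ∈ (D : Set (EuclideanSpace ℝ (Fin 3))), (∀ p ∈ (D : Set (EuclideanSpace ℝ (Fin 3))), dist p x ≤ 20 * (D.coveringRadius : ℝ) → g p = p) → ∀ y : EuclideanSpace ℝ (Fin 3), g y = y) →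
    (∀ A : EuclideanSpace ℝ (Fin 3) ≃ₗᵢ[ℝ] EuclideanSpace ℝ (Fin 3), (∀ x : EuclideanSpace ℝ (Fin 3), ‖A x - x‖ ≤ ‖x‖ / 2) → ∃ u : EuclideanSpace ℝ (Fin 3), ‖u‖ = 1 ∧ A u = u) →
    (∀ A : EuclideanSpace ℝ (Fin 3) ≃ₗᵢ[ℝ] EuclideanSpace ℝ (Fin 3), (∀ x : EuclideanSpace ℝ (Fin 3), ‖A x - x‖ ≤ ‖x‖ / 2) → ∀ u : EuclideanSpace ℝ (Fin 3), ‖u‖ = 1 → A u = u → (∃ x : EuclideanSpace ℝ (Fin 3), A x ≠ x) → ∀ v : EuclideanSpace ℝ (Fin 3), A v = v → ∃ c : ℝ, v = c • u) →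
    (∀ A B : EuclideanSpace ℝ (Fin 3) ≃ₗᵢ[ℝ] EuclideanSpace ℝ (Fin 3), (∀ x : EuclideanSpace ℝ (Fin 3), ‖A x - x‖ ≤ ‖x‖ / 2) → (∀ x : EuclideanSpace ℝ (Fin 3), ‖B x - x‖ ≤ ‖x‖ / 2) → ∀ u : EuclideanSpace ℝ (Fin 3), ‖u‖ = 1 → A u = u → B u = u → ∀ x : EuclideanSpace ℝ (Fin 3), A (B x) = B (A x)) →
    ∀ D : Delone.DeloneSet (EuclideanSpace ℝ (Fin 3)), ∀ g₁ g₂ : EuclideanSpace ℝ (Fin 3) ≃ᵃⁱ[ℝ] EuclideanSpace ℝ (Fin 3), g₁ '' (D : Set (EuclideanSpace ℝ (Fin 3))) = (D : Set (EuclideanSpace ℝ (Fin 3))) → g₂ '' (D : Set (EuclideanSpace ℝ (Fin 3))) = (D : Set (EuclideanSpace ℝ (Fin 3))) → (∀ x : EuclideanSpace ℝ (Fin 3), ‖g₁.linear x - x‖ ≤ ‖x‖ / 10) → (∀ x : EuclideanSpace ℝ (Fin 3), ‖g₂.linear x - x‖ ≤ ‖x‖ / 10) → ∀ x : EuclideanSpace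 ℝ (Fin 3), g₁.linear (g₂.linear x) = g₂.linear (g₁.linear x) := by
  intro hASL hT1 hT2 hT5 D g₁ g₂ hg₁ hg₂ hs₁ hs₂
  -- smallness of the linear parts, restated for the linear isometry equivalences
  have hA₁ : ∀ x, ‖g₁.linearIsometryEquiv x - x‖ ≤ 1 / 10 * ‖x‖ := fun x => by
    have h := hs₁ x
    change ‖g₁.linearIsometryEquiv x - x‖ ≤ ‖x‖ / 10 at h
    linarith
  have hA₂ : ∀ x, ‖g₂.linearIsometryEquiv x - x‖ ≤ 1 / 10 * ‖x‖ := fun x => by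
    have h := hs₂ x
    change ‖g₂.linearIsometryEquiv x - x‖ ≤ ‖x‖ / 10 at h
    linarith
  have hA₁' : ∀ x, ‖g₁.linearIsometryEquiv x - x‖ ≤ ‖x‖ / 2 := fun x => by
    have h := hA₁ x
    have h' := norm_nonneg x
    linarith
  have hA₂' : ∀ x, ‖g₂.linearIsometryEquiv x - x‖ ≤ ‖x‖ / 2 := fun x => by
    have h := hA₂ x
    have h' := norm_nonneg x
    linarith
  change ∀ x, g₁.linearIsometryEquiv (g₂.linearIsometryEquiv x) =
    g₂.linearIsometryEquiv (g₁.linearIsometryEquiv x)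
  -- the trivial case `A₁ = 1`
  by_cases htriv : ∀ x, g₁.linearIsometryEquiv x = x
  · intro x
    rw [htriv, htriv]
  push Not at htriv
  -- the axis of `A₁`
  obtain ⟨u, hu, hA₁u⟩ := hT1 _ hA₁'
  suffices hA₂u : g₂.linearIsometryEquiv u = u from hT5 _ _ hA₁' hA₂' u hu hA₁u hA₂u
  -- a base point
  obtain ⟨x₀, hx₀⟩ := D.nonempty
  -- the commutator sequence
  obtain ⟨κ, hκ0, hκs⟩ : ∃ κ : ℕ → (EuclideanSpace ℝ (Fin 3) ≃ᵃⁱ[ℝ] EuclideanSpace ℝ (Fin 3)),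
      κ 0 = g₂ ∧ ∀ j, κ (j + 1) = g₁ * κ j * g₁⁻¹ * (κ j)⁻¹ :=
    ⟨fun j => (fun h => g₁ * h * g₁⁻¹ * h⁻¹)^[j] g₂, rfl,
      fun j => Function.iterate_succ_apply' _ _ _⟩
  -- all `κ j` are symmetries of `D`
  have hκD : ∀ j, κ j '' (D : Set (EuclideanSpace ℝ (Fin 3))) = D := by
    intro j
    induction j with
    | zero => rw [hκ0]; exact hg₂
    | succ j ih =>
      rw [hκs]
      exact g1a_image_mul (g1a_image_mul (g1a_image_mul hg₁ ih) (g1a_image_inv hg₁))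
        (g1a_image_inv ih)
  -- joint geometric bounds on linear and translation parts
  set T₀ : ℝ := ‖g₂ x₀ - x₀‖ + ‖g₁ x₀ - x₀‖ with hT₀
  have hbound : ∀ j : ℕ,
      (∀ x, ‖(κ j).linearIsometryEquiv x - x‖ ≤ (1 / 10 * (1 / 2 : ℝ) ^ j) * ‖x‖) ∧
        ‖κ j x₀ - x₀‖ ≤ T₀ * (1 / 2 : ℝ) ^ j := by
    intro j
    induction j with
    | zero =>
      refine ⟨fun x => ?_, ?_⟩
      · rw [hκ0]
        simpa using hA₂ x
      · rw [hκ0, pow_zero, mul_one, hT₀]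
        exact le_add_of_nonneg_right (norm_nonneg _)
    | succ j ih =>
      obtain ⟨ihc, iht⟩ := ih
      have hc0 : 0 ≤ 1 / 10 * (1 / 2 : ℝ) ^ j := by positivity
      refine ⟨fun x => ?_, ?_⟩
      · rw [hκs]
        simp only [g1a_lin_mul, g1a_lin_inv]
        calc _ ≤ 2 * (1 / 10) * (1 / 10 * (1 / 2 : ℝ) ^ j) * ‖x‖ :=
              g1a_small_comm (by norm_num) hc0 hA₁ ihc x
          _ ≤ (1 / 10 * (1 / 2 : ℝ) ^ (j + 1)) * ‖x‖ := by
              rw [pow_succ]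
              have hx := norm_nonneg x
              nlinarith
      · rw [hκs]
        calc _ ≤ (1 / 10 * (1 / 2 : ℝ) ^ j) * ‖g₁ x₀ - x₀‖ +
              (1 / 10 + 2 * (1 / 10) * (1 / 10 * (1 / 2 : ℝ) ^ j)) * ‖κ j x₀ - x₀‖ :=
              g1a_t_comm_bound (by norm_num) hc0 hA₁ ihc x₀
          _ ≤ T₀ * (1 / 2 : ℝ) ^ (j + 1) := by
              rw [pow_succ]
              exact g1a_arith (by positivity) (pow_le_one₀ (by norm_num) (by norm_num))
                (by rw [hT₀]; exact le_add_of_nonneg_left (norm_nonneg _)) (norm_nonneg _) iht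
  -- discreteness: a far-out commutator fixes the patch `D ∩ B̄(x₀, 20 R_c)`, hence is the identity
  have hρ : (0 : ℝ) < D.packingRadius := D.packingRadius_pos
  have hR : (0 : ℝ) < D.coveringRadius := D.coveringRadius_pos
  have hT₀nn : 0 ≤ T₀ := by positivity
  obtain ⟨J, hJ⟩ := exists_pow_lt_of_lt_one
    (show (0 : ℝ) < D.packingRadius / (2 * D.coveringRadius + T₀) by positivity)
    (show (1 / 2 : ℝ) < 1 by norm_num)
  have hJ' : (1 / 2 : ℝ) ^ J * (2 * D.coveringRadius + T₀) < D.packingRadius := by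
    rwa [lt_div_iff₀ (by positivity)] at hJ
  have hfix : ∀ p ∈ (D : Set (EuclideanSpace ℝ (Fin 3))),
      dist p x₀ ≤ 20 * (D.coveringRadius : ℝ) → κ J p = p := by
    intro p hp hpd
    by_contra hne
    have hmem : κ J p ∈ (D : Set (EuclideanSpace ℝ (Fin 3))) := by
      rw [← hκD J]
      exact Set.mem_image_of_mem _ hp
    have hlt : (D.packingRadius : ℝ) < dist (κ J p) p := D.packingRadius_lt_dist_of_mem_ne hmem hp hne
    have hle : dist (κ J p) p ≤
        (1 / 10 * (1 / 2 : ℝ) ^ J) * (20 * D.coveringRadius) + T₀ * (1 / 2 : ℝ) ^ J := by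
      rw [dist_eq_norm, g1a_decomp (κ J) x₀ p]
      have h : (κ J).linearIsometryEquiv (p - x₀) + κ J x₀ - p =
          ((κ J).linearIsometryEquiv (p - x₀) - (p - x₀)) + (κ J x₀ - x₀) := by abel
      rw [h]
      refine (norm_add_le _ _).trans (add_le_add (((hbound J).1 _).trans ?_) (hbound J).2)
      rw [← dist_eq_norm]
      gcongr
    have heq : (1 / 10 * (1 / 2 : ℝ) ^ J) * (20 * D.coveringRadius) + T₀ * (1 / 2 : ℝ) ^ J =
        (1 / 2 : ℝ) ^ J * (2 * D.coveringRadius + T₀) := by ring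
    linarith
  have hκJ : ∀ y, κ J y = y := hASL D (κ J) x₀ hx₀ hfix
  have hCJ : ∀ v, (κ J).linearIsometryEquiv v = v := fun v => by
    have h := g1a_decomp (κ J) x₀ (v + x₀)
    rw [hκJ, hκJ, add_sub_cancel_right] at h
    exact ((add_left_inj _).mp h).symm
  -- downward induction on `C_j u = u`
  have hsymm_u : g₁.linearIsometryEquiv.symm u = u :=
    calc g₁.linearIsometryEquiv.symm u = g₁.linearIsometryEquiv.symm (g₁.linearIsometryEquiv u) := by
          rw [hA₁u]
      _ = u := g₁.linearIsometryEquiv.symm_apply_apply u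
  have step : ∀ j, (κ (j + 1)).linearIsometryEquiv u = u → (κ j).linearIsometryEquiv u = u := by
    intro j hj
    rw [hκs] at hj
    simp only [g1a_lin_mul, g1a_lin_inv] at hj
    set C := (κ j).linearIsometryEquiv with hC
    set v := C.symm u with hv
    have h1 : C (g₁.linearIsometryEquiv.symm v) = u := by
      have h := congrArg g₁.linearIsometryEquiv.symm hj
      rwa [LinearIsometryEquiv.symm_apply_apply, hsymm_u] at h
    have h2 : g₁.linearIsometryEquiv.symm v = v := by
      have h := congrArg C.symm h1
      rwa [LinearIsometryEquiv.symm_apply_apply] at h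
    have h3 : g₁.linearIsometryEquiv v = v := by
      have h := congrArg g₁.linearIsometryEquiv h2
      rw [LinearIsometryEquiv.apply_symm_apply] at h
      exact h.symm
    obtain ⟨c, hc⟩ := hT2 _ hA₁' u hu hA₁u htriv v h3
    have hvn : ‖v‖ = 1 := by rw [hv, LinearIsometryEquiv.norm_map, hu]
    have hc_abs : |c| = 1 := by
      have h := hvn
      rwa [hc, norm_smul, hu, mul_one, Real.norm_eq_abs] at h
    have hsmall : ‖v - u‖ ≤ 1 / 10 := by
      have h := g1a_small_symm (hbound j).1 u
      rw [hu, mul_one] at h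
      refine h.trans ?_
      exact mul_le_of_le_one_right (by norm_num) (pow_le_one₀ (by norm_num) (by norm_num))
    rcases (abs_eq zero_le_one).mp hc_abs with h | h
    · rw [h, one_smul] at hc
      calc C u = C v := by rw [hc]
        _ = u := by rw [hv]; exact C.apply_symm_apply u
    · exfalso
      rw [h, neg_one_smul] at hc
      rw [hc] at hsmall
      have h2u : ‖-u - u‖ = 2 := by
        rw [show -u - u = -((2 : ℝ) • u) by rw [two_smul]; abel, norm_neg, norm_smul, hu]
        norm_num
      linarith
  have hQ : ∀ k, k ≤ J → (κ (J - k)).linearIsometryEquiv u = u := by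
    intro k
    induction k with
    | zero => intro _; exact hCJ u
    | succ k ih =>
      intro hk
      have h1 := ih (Nat.le_of_succ_le hk)
      have hJk : J - k = J - (k + 1) + 1 := by omega
      rw [hJk] at h1
      exact step _ h1
  have h0 := hQ J le_rfl
  rwa [Nat.sub_self, hκ0] at h0

end Summit.AtomisticToContinuum.Crystallization.Theorems.IsometryAtomsAtomicLawChargesCrystal

end
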